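import Summits.NavierStokesRegularity.NavierStokesRegularity.Theorems.AdaptedFrequencyFrequencyRigidityFrameNormalisation
import HarnessLib

/-!
# Crux `FrequencyRigidity` (stmt-NavierStokesRegularity-2955), line `scaled-energy-split`: the EXACT split (glue)

Helper file (`--supports stmt-NavierStokesRegularity-2955`; theorems only, sorry-free).  The crux is EQUIVALENT to
the conjunction of the two children of the prepared `route edit --split` (strategist cstrat p1, children.json on the
item): the frame-invariant finite-scaled-energy piece (`FrequencyRigidityFiniteScaledEnergy`: no witness admitting a
smooth Type-I Galilean frame ending at the pole in which the wobbled triple has finite Albritton–Barker quantity) and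
the infinite-scaled-energy piece (`FrequencyRigidityInfiniteScaledEnergy`: no witness with `𝐈 = ⊤` in every such
frame).  `⇐` is excluded middle on the frame predicate (the line's composition `FrequencyRigidity_of`); `⇒` is
weakening.  With the landed Stub 1 (`stub_frameNormalisation`) the finite child is moreover equivalent to its
frame-`0` form (Stub 2's statement): `finitePiece_iff_frame0`.

## References

* D. Albritton, T. Barker, J. Math. Fluid Mech. 21 (2019), §1 (the quantity `𝐈`). [AlbrittonBarker2019]
* G. Koch, N. Nadirashvili, G. Seregin, V. Šverák, Acta Math. 203 (2009), §3 Lemma 3.1 (Galilean gauge). [KochNadirashviliSereginSverak2009]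
-/

noncomputable section

set_option linter.dupNamespace false

namespace Summit.NavierStokesRegularity.NavierStokesRegularity.Theorems.FrequencyRigidity.ScaledEnergySplit

/-- **The route's frame is admissible**: with `B ≡ 0` the frame predicate reduces to
`typeIBound (ℝ₋ × ℝ³) v q ∇v < ⊤`. [cite: AlbrittonBarker2019, §1] -/
theorem framePredicate_of_typeIBound_lt_top
    {v : ℝ → EuclideanSpace ℝ (Fin 3) → EuclideanSpace ℝ (Fin 3)} {q : ℝ → EuclideanSpace ℝ (Fin 3) → ℝ}
    (h : Literature.Analysis.FluidPDE.typeIBound (Set.Iio (0:ℝ) ×ˢ Set.univ) v q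
      (fun t x => fderiv ℝ (v t) x) < ⊤) :
    ∃ (B : ℝ → EuclideanSpace ℝ (Fin 3)) (C_B : ℝ), ContDiffOn ℝ (⊤ : ℕ∞) B (Set.Iio (0:ℝ)) ∧ (∀ t < (0:ℝ), ‖deriv B t‖ ≤ C_B / Real.sqrt (-t)) ∧ Filter.Tendsto B (nhdsWithin (0:ℝ) (Set.Iio (0:ℝ))) (nhds (0 : EuclideanSpace ℝ (Fin 3))) ∧ Literature.Analysis.FluidPDE.typeIBound (Set.Iio (0:ℝ) ×ˢ Set.univ) (fun t x => v t (x - B t) + deriv B t) (fun t x => q t (x - B t) - inner ℝ (deriv (deriv B) t) x) (fun t x => fderiv ℝ (v t) (x - B t)) < ⊤ := by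
  refine ⟨fun _ => 0, 0, contDiffOn_const, ?_, tendsto_const_nhds, ?_⟩
  · intro t ht; simp
  · simpa using h

/-- **Registered sub-goal `stub_scaledEnergySplitGlue`: the crux is EQUIVALENT to (finite piece) ∧ (infinite
piece)** — the prepared split is exact. [cite: AlbrittonBarker2019, §1] -/
theorem stub_scaledEnergySplitGlue : Summit.NavierStokesRegularity.NavierStokesRegularity.Theses.AdaptedFrequency.FrequencyRigidity ↔ ((¬ ∃ (ν C Λ₀ : ℝ) (v : ℝ → EuclideanSpace ℝ (Fin 3) → EuclideanSpace ℝ (Fin 3)) (q : ℝ → EuclideanSpace ℝ (Fin 3) → ℝ) (K : ℝ → EuclideanSpace ℝ (Fin 3) → ℝ), (0 < ν ∧ Literature.Analysis.FluidPDE.IsClassicalNSSolutionOn (Set.Iio 0) ν 0 v q ∧ (∀ t ∈ Set.Iio (0:ℝ), ∀ x, ‖v t x‖ ≤ C / Real.sqrt (-t)) ∧ ContDiffOn ℝ 2 (Function.uncurry K) (Set.Iio (0:ℝ) ×ˢ Set.univ) ∧ (∀ t ∈ Set.Iio (0:ℝ), ∀ x, 0 < K t x) ∧ (∀ t ∈ Set.Iio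 (0:ℝ), ∀ x, Literature.Analysis.FluidPDE.timeDerivWithin (Set.Iio (0:ℝ)) K t x + fderiv ℝ (K t) x (v t x) + ν * Laplacian.laplacian (K t) x = 0) ∧ (∀ t ∈ Set.Iio (0:ℝ), ∫ x, K t x = 1) ∧ (∀ φ : EuclideanSpace ℝ (Fin 3) → ℝ, Continuous φ → (∃ M : ℝ, ∀ x, |φ x| ≤ M) → Filter.Tendsto (fun t => ∫ x, φ x * K t x) (nhdsWithin (0:ℝ) (Set.Iio (0:ℝ))) (nhds (φ (0 : EuclideanSpace ℝ (Fin 3))))) ∧ (∃ c₁ c₂ C₁ C₂ : ℝ, 0 < c₁ ∧ 0 < c₂ ∧ 0 < C₁ ∧ 0 < C₂ ∧ ∀ t ∈ Set.Iio (0:ℝ), ∀ x, c₁ * ((0:ℝ) - t) ^ (-(3:ℝ) / 2) * Real.exp (-(‖x - (0 : EuclideanSpace ℝ (Fin 3))‖ ^ 2) / (c₂ * ((0:ℝ) - t))) ≤ K t x ∧ K t x ≤ C₁ * ((0:ℝ) - t) ^ (-(3:ℝ) / 2) * Real.exp (-(‖x - (0 : EuclideanSpace ℝ (Fin 3))‖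 ^ 2) / (C₂ * ((0:ℝ) - t)))) ∧ (∀ H Λ : ℝ → ℝ, H = (fun t => ∫ x, ‖Literature.Analysis.FluidPDE.curl (v t) x‖ ^ 2 * K t x) → Λ = (fun t => (0 - t) * deriv H t / H t) → (∀ t ∈ Set.Iio (0:ℝ), 0 < H t) ∧ (∀ t ∈ Set.Iio (0:ℝ), Λ t = Λ₀))) ∧ (∃ (B : ℝ → EuclideanSpace ℝ (Fin 3)) (C_B : ℝ), ContDiffOn ℝ (⊤ : ℕ∞) B (Set.Iio (0:ℝ)) ∧ (∀ t < (0:ℝ), ‖deriv B t‖ ≤ C_B / Real.sqrt (-t)) ∧ Filter.Tendsto B (nhdsWithin (0:ℝ) (Set.Iio (0:ℝ))) (nhds (0 : EuclideanSpace ℝ (Fin 3))) ∧ Literature.Analysis.FluidPDE.typeIBound (Set.Iio (0:ℝ) ×ˢ Set.univ) (fun t x => v t (x - B t) + deriv B t) (fun t x => q t (x - B t) - inner ℝ (deriv (deriv B) t) x) (fun t x => fderiv ℝ (v t) (x - B t)) < ⊤)) ∧ (¬ ∃ (ν C Λ₀ : ℝ) (v : ℝ → EuclideanSpace ℝ (Fin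 3) → EuclideanSpace ℝ (Fin 3)) (q : ℝ → EuclideanSpace ℝ (Fin 3) → ℝ) (K : ℝ → EuclideanSpace ℝ (Fin 3) → ℝ), (0 < ν ∧ Literature.Analysis.FluidPDE.IsClassicalNSSolutionOn (Set.Iio 0) ν 0 v q ∧ (∀ t ∈ Set.Iio (0:ℝ), ∀ x, ‖v t x‖ ≤ C / Real.sqrt (-t)) ∧ ContDiffOn ℝ 2 (Function.uncurry K) (Set.Iio (0:ℝ) ×ˢ Set.univ) ∧ (∀ t ∈ Set.Iio (0:ℝ), ∀ x, 0 < K t x) ∧ (∀ t ∈ Set.Iio (0:ℝ), ∀ x, Literature.Analysis.FluidPDE.timeDerivWithin (Set.Iio (0:ℝ)) K t x + fderiv ℝ (K t) x (v t x) + ν * Laplacian.laplacian (K t) x = 0) ∧ (∀ t ∈ Set.Iio (0:ℝ), ∫ x, K t x = 1) ∧ (∀ φ : EuclideanSpace ℝ (Fin 3) → ℝ, Continuous φ → (∃ M : ℝ, ∀ x, |φ x| ≤ M) → Filter.Tendsto (fun t => ∫ x, φ x * K t x) (nhdsWithin (0:ℝ) (Set.Iio (0:ℝ))) (nhds (φ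 (0 : EuclideanSpace ℝ (Fin 3))))) ∧ (∃ c₁ c₂ C₁ C₂ : ℝ, 0 < c₁ ∧ 0 < c₂ ∧ 0 < C₁ ∧ 0 < C₂ ∧ ∀ t ∈ Set.Iio (0:ℝ), ∀ x, c₁ * ((0:ℝ) - t) ^ (-(3:ℝ) / 2) * Real.exp (-(‖x - (0 : EuclideanSpace ℝ (Fin 3))‖ ^ 2) / (c₂ * ((0:ℝ) - t))) ≤ K t x ∧ K t x ≤ C₁ * ((0:ℝ) - t) ^ (-(3:ℝ) / 2) * Real.exp (-(‖x - (0 : EuclideanSpace ℝ (Fin 3))‖ ^ 2) / (C₂ * ((0:ℝ) - t)))) ∧ (∀ H Λ : ℝ → ℝ, H = (fun t => ∫ x, ‖Literature.Analysis.FluidPDE.curl (v t) x‖ ^ 2 * K t x) → Λ = (fun t => (0 - t) * deriv H t / H t) → (∀ t ∈ Set.Iio (0:ℝ), 0 < H t) ∧ (∀ t ∈ Set.Iio (0:ℝ), Λ t = Λ₀))) ∧ ¬ (∃ (B : ℝ → EuclideanSpace ℝ (Fin 3)) (C_B : ℝ), ContDiffOn ℝ (⊤ : ℕ∞) B (Set.Iio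 (0:ℝ)) ∧ (∀ t < (0:ℝ), ‖deriv B t‖ ≤ C_B / Real.sqrt (-t)) ∧ Filter.Tendsto B (nhdsWithin (0:ℝ) (Set.Iio (0:ℝ))) (nhds (0 : EuclideanSpace ℝ (Fin 3))) ∧ Literature.Analysis.FluidPDE.typeIBound (Set.Iio (0:ℝ) ×ˢ Set.univ) (fun t x => v t (x - B t) + deriv B t) (fun t x => q t (x - B t) - inner ℝ (deriv (deriv B) t) x) (fun t x => fderiv ℝ (v t) (x - B t)) < ⊤))) := by
  unfold Summit.NavierStokesRegularity.NavierStokesRegularity.Theses.AdaptedFrequency.FrequencyRigidity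
  constructor
  · intro h
    exact ⟨fun ⟨ν, C, Λ₀, v, q, K, hbody, _⟩ => h ⟨ν, C, Λ₀, v, q, K, hbody⟩,
      fun ⟨ν, C, Λ₀, v, q, K, hbody, _⟩ => h ⟨ν, C, Λ₀, v, q, K, hbody⟩⟩
  · rintro ⟨h1, h2⟩ ⟨ν, C, Λ₀, v, q, K, hbody⟩
    by_cases hP : ∃ (B : ℝ → EuclideanSpace ℝ (Fin 3)) (C_B : ℝ), ContDiffOn ℝ (⊤ : ℕ∞) B (Set.Iio (0:ℝ)) ∧ (∀ t < (0:ℝ), ‖deriv B t‖ ≤ C_B / Real.sqrt (-t)) ∧ Filter.Tendsto B (nhdsWithin (0:ℝ) (Set.Iio (0:ℝ))) (nhds (0 : EuclideanSpace ℝ (Fin 3))) ∧ Literature.Analysis.FluidPDE.typeIBound (Set.Iio (0:ℝ) ×ˢ Set.univ) (fun t x => v t (x - B t) + deriv B t) (fun t x => q t (x - B t) - inner ℝ (deriv (deriv B) t) x) (fun t x => fderiv ℝ (v t) (x - B t)) < ⊤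
    · exact h1 ⟨ν, C, Λ₀, v, q, K, hbody, hP⟩
    · exact h2 ⟨ν, C, Λ₀, v, q, K, hbody, hP⟩

/-- **The finite child is equivalent to its frame-`0` form** (Stub 2's statement), by the landed Galilean gauge
fixing `stub_frameNormalisation` and `framePredicate_of_typeIBound_lt_top`. [cite: KochNadirashviliSereginSverak2009, §3 Lemma 3.1] -/
theorem finitePiece_iff_frame0 :
    (¬ ∃ (ν C Λ₀ : ℝ) (v : ℝ → EuclideanSpace ℝ (Fin 3) → EuclideanSpace ℝ (Fin 3)) (q : ℝ → EuclideanSpace ℝ (Fin 3) → ℝ) (K : ℝ → EuclideanSpace ℝ (Fin 3) → ℝ), (0 < ν ∧ Literature.Analysis.FluidPDE.IsClassicalNSSolutionOn (Set.Iio 0) ν 0 v q ∧ (∀ t ∈ Set.Iio (0:ℝ), ∀ x, ‖v t x‖ ≤ C / Real.sqrt (-t)) ∧ ContDiffOn ℝ 2 (Function.uncurry K) (Set.Iio (0:ℝ) ×ˢ Set.univ) ∧ (∀ t ∈ Set.Iio (0:ℝ), ∀ x, 0 < K t x) ∧ (∀ t ∈ Set.Iio (0:ℝ), ∀ x, Literature.Analysis.FluidPDE.timeDerivWithin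 (Set.Iio (0:ℝ)) K t x + fderiv ℝ (K t) x (v t x) + ν * Laplacian.laplacian (K t) x = 0) ∧ (∀ t ∈ Set.Iio (0:ℝ), ∫ x, K t x = 1) ∧ (∀ φ : EuclideanSpace ℝ (Fin 3) → ℝ, Continuous φ → (∃ M : ℝ, ∀ x, |φ x| ≤ M) → Filter.Tendsto (fun t => ∫ x, φ x * K t x) (nhdsWithin (0:ℝ) (Set.Iio (0:ℝ))) (nhds (φ (0 : EuclideanSpace ℝ (Fin 3))))) ∧ (∃ c₁ c₂ C₁ C₂ : ℝ, 0 < c₁ ∧ 0 < c₂ ∧ 0 < C₁ ∧ 0 < C₂ ∧ ∀ t ∈ Set.Iio (0:ℝ), ∀ x, c₁ * ((0:ℝ) - t) ^ (-(3:ℝ) / 2) * Real.exp (-(‖x - (0 : EuclideanSpace ℝ (Fin 3))‖ ^ 2) / (c₂ * ((0:ℝ) - t))) ≤ K t x ∧ K t x ≤ C₁ * ((0:ℝ) - t) ^ (-(3:ℝ) / 2) * Real.exp (-(‖x - (0 : EuclideanSpace ℝ (Fin 3))‖ ^ 2) / (C₂ * ((0:ℝ) - t)))) ∧ (∀ H Λ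 : ℝ → ℝ, H = (fun t => ∫ x, ‖Literature.Analysis.FluidPDE.curl (v t) x‖ ^ 2 * K t x) → Λ = (fun t => (0 - t) * deriv H t / H t) → (∀ t ∈ Set.Iio (0:ℝ), 0 < H t) ∧ (∀ t ∈ Set.Iio (0:ℝ), Λ t = Λ₀))) ∧ (∃ (B : ℝ → EuclideanSpace ℝ (Fin 3)) (C_B : ℝ), ContDiffOn ℝ (⊤ : ℕ∞) B (Set.Iio (0:ℝ)) ∧ (∀ t < (0:ℝ), ‖deriv B t‖ ≤ C_B / Real.sqrt (-t)) ∧ Filter.Tendsto B (nhdsWithin (0:ℝ) (Set.Iio (0:ℝ))) (nhds (0 : EuclideanSpace ℝ (Fin 3))) ∧ Literature.Analysis.FluidPDE.typeIBound (Set.Iio (0:ℝ) ×ˢ Set.univ) (fun t x => v t (x - B t) + deriv B t) (fun t x => q t (x - B t) - inner ℝ (deriv (deriv B) t) x) (fun t x => fderiv ℝ (v t) (x - B t)) < ⊤)) ↔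
    (¬ ∃ (ν C Λ₀ : ℝ) (v : ℝ → EuclideanSpace ℝ (Fin 3) → EuclideanSpace ℝ (Fin 3)) (q : ℝ → EuclideanSpace ℝ (Fin 3) → ℝ) (K : ℝ → EuclideanSpace ℝ (Fin 3) → ℝ), (0 < ν ∧ Literature.Analysis.FluidPDE.IsClassicalNSSolutionOn (Set.Iio 0) ν 0 v q ∧ (∀ t ∈ Set.Iio (0:ℝ), ∀ x, ‖v t x‖ ≤ C / Real.sqrt (-t)) ∧ ContDiffOn ℝ 2 (Function.uncurry K) (Set.Iio (0:ℝ) ×ˢ Set.univ) ∧ (∀ t ∈ Set.Iio (0:ℝ), ∀ x, 0 < K t x) ∧ (∀ t ∈ Set.Iio (0:ℝ), ∀ x, Literature.Analysis.FluidPDE.timeDerivWithin (Set.Iio (0:ℝ)) K t x + fderiv ℝ (K t) x (v t x) + ν * Laplacian.laplacian (K t) x = 0) ∧ (∀ t ∈ Set.Iio (0:ℝ), ∫ x, K t x = 1) ∧ (∀ φ : EuclideanSpace ℝ (Fin 3) → ℝ, Continuous φ → (∃ M : ℝ, ∀ x, |φ x| ≤ M) → Filter.Tendsto (fun t => ∫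 x, φ x * K t x) (nhdsWithin (0:ℝ) (Set.Iio (0:ℝ))) (nhds (φ (0 : EuclideanSpace ℝ (Fin 3))))) ∧ (∃ c₁ c₂ C₁ C₂ : ℝ, 0 < c₁ ∧ 0 < c₂ ∧ 0 < C₁ ∧ 0 < C₂ ∧ ∀ t ∈ Set.Iio (0:ℝ), ∀ x, c₁ * ((0:ℝ) - t) ^ (-(3:ℝ) / 2) * Real.exp (-(‖x - (0 : EuclideanSpace ℝ (Fin 3))‖ ^ 2) / (c₂ * ((0:ℝ) - t))) ≤ K t x ∧ K t x ≤ C₁ * ((0:ℝ) - t) ^ (-(3:ℝ) / 2) * Real.exp (-(‖x - (0 : EuclideanSpace ℝ (Fin 3))‖ ^ 2) / (C₂ * ((0:ℝ) - t)))) ∧ (∀ H Λ : ℝ → ℝ, H = (fun t => ∫ x, ‖Literature.Analysis.FluidPDE.curl (v t) x‖ ^ 2 * K t x) → Λ = (fun t => (0 - t) * deriv H t / H t) → (∀ t ∈ Set.Iio (0:ℝ), 0 < H t) ∧ (∀ t ∈ Set.Iio (0:ℝ), Λ t = Λ₀))) ∧ Literature.Analysis.FluidPDE.typeIBound (Set.Iio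 (0:ℝ) ×ˢ Set.univ) v q (fun t x => fderiv ℝ (v t) x) < ⊤) := by
  constructor
  · rintro h ⟨ν, C, Λ₀, v, q, K, hbody, hI⟩
    exact h ⟨ν, C, Λ₀, v, q, K, hbody, framePredicate_of_typeIBound_lt_top hI⟩
  · exact stub_frameNormalisation

end Summit.NavierStokesRegularity.NavierStokesRegularity.Theorems.FrequencyRigidity.ScaledEnergySplit

end
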